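import Mathlib
import HarnessLib
import Summits.ABC.ABC.Theses.NegOmegaAtlas
import Summits.ABC.ABC.Theses.IneffectiveSubspace
import Summits.ABC.ABC.Theorems.NegOmegaAtlasAssembly
import Summits.ABC.ABC.Theorems.IneffectiveSubspaceUniformSadicTowerFourKillPaths
import Summits.ABC.ABC.Theorems.IneffectiveSubspaceDeepRegimeABCOmegaTail
import Literature.NumberTheory.DiophantineGeometry.AbcWave0QualityFormProofs

/-!
# Strategy census r1 (Lean side) for the crux `NegThesis` (stmt-ABC-1224, route `NegOmegaAtlas`)

Companion of the r1 section of `STRATEGY-CENSUS.md` (crux-strategist REDIRECT seat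
`planner-cstrat-stmt-ABC-1224-r1-0`, 2026-08-17).  The s1 companion `StrategyCensus.lean` (fixed /
nested support refuted, gap law, seed/self-map, k ≤ 2) is untouched and not repeated.  This file adds,
sorry-free:

* §0 SUMMIT STRENGTH BY NAME — `summit_strength : Assembly` (`Assembly` = `NegThesis → ¬ABC`) is the landed
  `Summit.ABC.ABC.Theorems.negOmegaAtlasAssembly_proof`; with the landed
  `DeepRegimeABC.abc_iff_deepRegimeABC_and_boundedOmega` and
  `UniformSadicTowerFour.BoundedOmega.boundedOmega_iff_not_negThesis` we record
  `abc_iff_deepRegime_and_not_negThesis : ABC ↔ DeepRegimeABC ∧ ¬NegThesis`, hence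
  `negThesis_iff_not_abc (h₆ : DeepRegimeABC) : NegThesis ↔ ¬ABC` and
  `not_abc_iff : ¬ABC ↔ NegThesis ∨ ¬DeepRegimeABC` — the crux is the bounded-ω DISJUNCT of the
  route's conclusion `¬ABC`, and modulo the (abc-implied, open) tail statement `DeepRegimeABC`
  (stmt-ABC-15121) it IS `¬ABC`.
* §1 POLARITY — `polarity F : (∃ δ > 0, {abc triples with F and quality > 1+δ}.Infinite) → ¬ABC` for an
  ARBITRARY side condition `F`: every piece of every decomposition of the crux that retains the margin
  `δ` is already at least the route's conclusion (so it can never be the "strictly weaker, planned"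
  piece of a split), while the δ-free pieces (`BoundedOmegaHits`) are consequences of the crux
  (`boundedOmegaHits_of_negThesis`) that abc does not contradict.
* §2 SUPPLY DIAL — `negThesis_iff_powerSaving : NegThesis ↔ ∃ k θ, 0 < θ < 1 ∧ {ω ≤ k, rad(abc) <
  c^(1-θ)}.Infinite`: a hit supply with ANY power saving is the crux itself (δ = θ/(1-θ)); only
  sub-power savings (quality → 1⁺) are abc-consistent, and those are exactly what every known
  construction delivers (census §T-r1).
* §3 FIXED BASE ⟹ SUPER-WIEFERICH — the LTE engine
  `padicValNat_pow_sub_one_le : v_q(a^x - 1) ≤ w_q(a) + v_q(x)` (`w_q(a) = v_q(a^{ord_q a} - 1)`, the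
  Wieferich depth, `wDepth`) is PROVED from Mathlib's lifting-the-exponent lemma; the reduction
  "an infinite fixed-base sub-family `(1, a^x - 1, a^x)` of the crux forces infinitely many
  `c`-super-Wieferich primes `q` (depth ≥ 2 and `q^{w_q(a)-1} ≥ a^{c·ord_q(a)}`), `c = δ/(2(1+δ)k)`" is
  STATED as `FixedBaseNeedsSuperWieferich` and PROVED as `fixedBaseNeedsSuperWieferich` (§3b: uniform
  LTE engine `padicValNat_pow_sub_one_le_depthBound` incl. the prime 2, radical/cofactor identity,
  pigeonhole over `≤ k` primes, real-exponent bookkeeping, eventual domination `x^k = o(a^{cx})`);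
  `fixedBase_sub_crux` checks that the fixed-base family is a genuine sub-family of the crux; the two
  known base-2 Wieferich primes are checked to have depth exactly 2 at their orders 364, 1755 (kernel
  arithmetic).

No `sorry`.  Nothing here is registered as a line or a stub; `Lines/birth.lean` and its stubs are
untouched.
-/

set_option linter.dupNamespace false

namespace Summit.ABC.ABC.Cruxes.NegThesis.StrategyCensusR1

open Literature.NumberTheory.DiophantineGeometry
open Summit.ABC.ABC.Theses.NegOmegaAtlas
open Summit.ABC.ABC.Theses.IneffectiveSubspace (DeepRegimeABC)
open UniqueFactorizationMonoid (radical radical_ne_zero radical_dvd_radical)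

/-! ## §0 Summit strength, by name -/

/-- **C ⇒ S by name.** The crux implies the route's conclusion `¬ABC`; this is the landed assembly
theorem `Summit.ABC.ABC.Theorems.negOmegaAtlasAssembly_proof` (stmt-ABC-1232, closed). [folklore] -/
theorem summit_strength : Assembly :=
  Summit.ABC.ABC.Theorems.negOmegaAtlasAssembly_proof

/-- `Assembly` unfolds to `NegThesis → ¬ABC` (by `rfl`). [folklore] -/
theorem assembly_iff : Assembly ↔ (NegThesis → ¬ _root_.ABC) := Iff.rfl

/-- abc with a constant `C(W, ε)` on every bounded-`ω` cell (the formula called `BoundedOmegaABC` in the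
twin crux's files; = `stub_boundedOmega` of the live skeleton v5 of stmt-ABC-14937). [folklore] -/
def BoundedOmegaCorner : Prop :=
  ∀ W : ℕ, ∀ ε : ℝ, 0 < ε → ∃ C : ℝ, 0 < C ∧ ∀ a b c : ℕ, IsABCTriple a b c →
    (a * b * c).primeFactors.card ≤ W → (c : ℝ) < C * ((rad a b c : ℕ) : ℝ) ^ (1 + ε)

/-- `BoundedOmegaCorner ↔ ¬NegThesis` (landed, `boundedOmega_iff_not_negThesis`). [folklore] -/
theorem boundedOmegaCorner_iff_not_negThesis : BoundedOmegaCorner ↔ ¬ NegThesis :=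
  Summit.ABC.ABC.Theorems.UniformSadicTowerFour.BoundedOmega.boundedOmega_iff_not_negThesis

/-- **`ABC ↔ DeepRegimeABC ∧ ¬NegThesis`** (landed `abc_iff_deepRegimeABC_and_boundedOmega` +
`boundedOmega_iff_not_negThesis`). [folklore] -/
theorem abc_iff_deepRegime_and_not_negThesis : _root_.ABC ↔ DeepRegimeABC ∧ ¬ NegThesis := by
  rw [Summit.ABC.ABC.Theorems.DeepRegimeABC.abc_iff_deepRegimeABC_and_boundedOmega]
  exact and_congr_right fun _ => boundedOmegaCorner_iff_not_negThesis

/-- **Modulo the tail statement the crux IS the summit's negation.** [folklore] -/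
theorem negThesis_iff_not_abc (h₆ : DeepRegimeABC) : NegThesis ↔ ¬ _root_.ABC := by
  rw [abc_iff_deepRegime_and_not_negThesis]
  tauto

/-- **`¬ABC ↔ NegThesis ∨ ¬DeepRegimeABC`**: the crux is the bounded-`ω` disjunct of the route's
conclusion. [folklore] -/
theorem not_abc_iff : ¬ _root_.ABC ↔ NegThesis ∨ ¬ DeepRegimeABC := by
  rw [abc_iff_deepRegime_and_not_negThesis]
  tauto

/-! ## §1 Polarity: every δ-retaining piece is at least the route's conclusion -/

/-- The δ-piece of the abc triples carved out by an arbitrary side condition `F`. [folklore] -/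
def Piece (F : ℕ × ℕ × ℕ → Prop) (δ : ℝ) : Set (ℕ × ℕ × ℕ) :=
  {t | IsABCTriple t.1 t.2.1 t.2.2 ∧ F t ∧ 1 + δ < quality t.1 t.2.1 t.2.2}

/-- **Polarity lemma.** For EVERY side condition `F` (bounded ω, unbalanced, balanced, fixed base,
super-Wieferich support, "obtained by breeding", …): infinitely many abc triples satisfying `F` with
quality `> 1 + δ` already refute `ABC`.  Hence no decomposition of the crux has a δ-retaining piece that
is strictly weaker than the route's conclusion. [folklore] -/
theorem polarity (F : ℕ × ℕ × ℕ → Prop) {δ : ℝ} (hδ : 0 < δ) (h : (Piece F δ).Infinite) :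
    ¬ _root_.ABC := by
  intro habc
  have hq : ABCQualityForm := abcQualityForm_of_forall_exists_const (ABC_iff.mp habc)
  exact h ((hq δ hδ).subset fun t ht => ⟨ht.1, ht.2.2⟩)

/-- Instance: the level-`k` piece of the crux (any single `k`). [folklore] -/
theorem polarity_level (k : ℕ) {δ : ℝ} (hδ : 0 < δ)
    (h : {t : ℕ × ℕ × ℕ | IsABCTriple t.1 t.2.1 t.2.2 ∧ (t.1 * t.2.1 * t.2.2).primeFactors.card ≤ k ∧
      1 + δ < quality t.1 t.2.1 t.2.2}.Infinite) : ¬ _root_.ABC :=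
  polarity (fun t => (t.1 * t.2.1 * t.2.2).primeFactors.card ≤ k) hδ h

/-- Instances: the route's three cell cruxes each carry `¬ABC` on their own (landed kill paths).
[folklore] -/
theorem polarity_cells :
    (UnbalancedFamily → ¬ _root_.ABC) ∧ (BalancedFamily → ¬ _root_.ABC) ∧
      (ThreeSlotFamily → ¬ _root_.ABC) :=
  ⟨fun h => assembly_iff.mp summit_strength
      (Summit.ABC.ABC.Theorems.UniformSadicTowerFour.BoundedOmega.negThesis_of_unbalancedFamily h),
    fun h => assembly_iff.mp summit_strength
      (Summit.ABC.ABC.Theorems.UniformSadicTowerFour.BoundedOmega.negThesis_of_balancedFamily h),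
    fun h => assembly_iff.mp summit_strength
      (Summit.ABC.ABC.Theorems.UniformSadicTowerFour.BoundedOmega.negThesis_of_threeSlotFamily h)⟩

/-- The δ-free piece: infinitely many bounded-`ω` hits (quality `> 1`) — `stub_boundedOmegaHits` of the
registered line `Lines/birth.lean`, re-typed here (not imported). [folklore] -/
def BoundedOmegaHits : Prop :=
  ∃ k : ℕ, {t : ℕ × ℕ × ℕ | IsABCTriple t.1 t.2.1 t.2.2 ∧ (t.1 * t.2.1 * t.2.2).primeFactors.card ≤ k ∧
    1 < quality t.1 t.2.1 t.2.2}.Infinite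

/-- The δ-free piece is a CONSEQUENCE of the crux (so, as a piece of a split, it is the `S → C`
direction: informative only through the arrow that re-adds δ, and that arrow is `≥ ¬ABC` by
`polarity`). [folklore] -/
theorem boundedOmegaHits_of_negThesis (h : NegThesis) : BoundedOmegaHits := by
  obtain ⟨k, δ, hδ, hinf⟩ := h
  exact ⟨k, hinf.mono fun t ht => ⟨ht.1, ht.2.1, by linarith [ht.2.2]⟩⟩

/-! ## §2 The supply dial: any power saving is the crux -/

/-- Level-`k` abc triples whose radical saves a fixed POWER of `c`: `rad(abc) < c^(1-θ)`. [folklore] -/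
def PowerSaving (k : ℕ) (θ : ℝ) : Set (ℕ × ℕ × ℕ) :=
  {t | IsABCTriple t.1 t.2.1 t.2.2 ∧ (t.1 * t.2.1 * t.2.2).primeFactors.card ≤ k ∧
    ((rad t.1 t.2.1 t.2.2 : ℕ) : ℝ) < (t.2.2 : ℝ) ^ (1 - θ)}

/-- quality `> 1 + δ` ⟹ `rad(abc) < c^(1 - δ/(1+δ))`. [folklore] -/
theorem rad_lt_rpow_of_quality {a b c : ℕ} (h : IsABCTriple a b c) {δ : ℝ} (hδ : 0 < δ)
    (hq : 1 + δ < quality a b c) : ((rad a b c : ℕ) : ℝ) < (c : ℝ) ^ (1 - δ / (1 + δ)) := by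
  rw [h.one_add_lt_quality_iff] at hq
  have hr0 : (0 : ℝ) ≤ ((rad a b c : ℕ) : ℝ) := Nat.cast_nonneg _
  have h1 : (0 : ℝ) < 1 + δ := by linarith
  have h1ne : (1 + δ : ℝ) ≠ 0 := h1.ne'
  have hexp : (1 : ℝ) - δ / (1 + δ) = (1 + δ)⁻¹ := by
    field_simp
    ring
  rw [hexp]
  calc ((rad a b c : ℕ) : ℝ) = ((((rad a b c : ℕ) : ℝ)) ^ (1 + δ)) ^ (1 + δ)⁻¹ :=
        (Real.rpow_rpow_inv hr0 h1ne).symm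
    _ < (c : ℝ) ^ (1 + δ)⁻¹ := Real.rpow_lt_rpow (Real.rpow_nonneg hr0 _) hq (inv_pos.mpr h1)

/-- `rad(abc) < c^(1-θ)` with `0 < θ < 1` ⟹ quality `> 1 + θ/(1-θ)`. [folklore] -/
theorem quality_of_rad_lt_rpow {a b c : ℕ} (h : IsABCTriple a b c) {θ : ℝ} (hθ1 : θ < 1)
    (hr : ((rad a b c : ℕ) : ℝ) < (c : ℝ) ^ (1 - θ)) : 1 + θ / (1 - θ) < quality a b c := by
  rw [h.one_add_lt_quality_iff]
  have hr0 : (0 : ℝ) ≤ ((rad a b c : ℕ) : ℝ) := Nat.cast_nonneg _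
  have hc0 : (0 : ℝ) ≤ (c : ℝ) := Nat.cast_nonneg _
  have h1 : (0 : ℝ) < 1 - θ := by linarith
  have h1ne : (1 - θ : ℝ) ≠ 0 := h1.ne'
  have hexp : (1 : ℝ) + θ / (1 - θ) = (1 - θ)⁻¹ := by
    field_simp
    ring
  rw [hexp]
  calc (((rad a b c : ℕ) : ℝ)) ^ (1 - θ)⁻¹ < ((c : ℝ) ^ (1 - θ)) ^ (1 - θ)⁻¹ :=
        Real.rpow_lt_rpow hr0 hr (inv_pos.mpr h1)
    _ = c := Real.rpow_rpow_inv hc0 h1ne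

/-- **Supply dial.** The crux is equivalent to: some level `k` carries infinitely many abc triples with
a POWER saving `rad(abc) < c^(1-θ)`, `0 < θ < 1`.  So the only abc-consistent hit supplies are the
sub-power ones (quality `→ 1⁺`) — which is all that every known construction gives (census §T-r1) — and
the registered cut `hits ∧ (hits → δ)` of `Lines/birth.lean` is optimal from this second angle too:
there is no intermediate dial position between "hits" and "the crux". [folklore] -/
theorem negThesis_iff_powerSaving :
    NegThesis ↔ ∃ k : ℕ, ∃ θ : ℝ, 0 < θ ∧ θ < 1 ∧ (PowerSaving k θ).Infinite := by
  constructor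
  · rintro ⟨k, δ, hδ, hinf⟩
    have h1 : (0 : ℝ) < 1 + δ := by linarith
    refine ⟨k, δ / (1 + δ), div_pos hδ h1, (div_lt_one h1).mpr (by linarith), ?_⟩
    exact hinf.mono fun t ht => ⟨ht.1, ht.2.1, rad_lt_rpow_of_quality ht.1 hδ ht.2.2⟩
  · rintro ⟨k, θ, hθ, hθ1, hinf⟩
    refine ⟨k, θ / (1 - θ), div_pos hθ (by linarith), ?_⟩
    exact hinf.mono fun t ht => ⟨ht.1, ht.2.1, quality_of_rad_lt_rpow ht.1 hθ1 ht.2.2⟩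

/-! ## §3 Fixed base ⟹ super-Wieferich primes (LTE engine and the reduction, both PROVED) -/

/-- The **Wieferich depth** of the base `a` at the prime `q`: `w_q(a) = v_q(a^{ord_q(a)} - 1)`
(`≥ 1` for `q ∤ a`; `≥ 2` iff `q` is a base-`a` Wieferich prime). [folklore] -/
noncomputable def wDepth (a q : ℕ) : ℕ :=
  padicValNat q (a ^ orderOf (a : ZMod q) - 1)

/-- `ord_q(a) > 0` for a prime `q ∤ a` (Fermat). [folklore] -/
theorem orderOf_pos_of_not_dvd {a q : ℕ} (hq : q.Prime) (hqa : ¬ q ∣ a) :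
    0 < orderOf (a : ZMod q) := by
  haveI := Fact.mk hq
  have ha : (a : ZMod q) ≠ 0 := by
    rw [Ne, ZMod.natCast_eq_zero_iff]
    exact hqa
  have hq1 : 0 < q - 1 := by
    have := hq.two_le
    omega
  exact (isOfFinOrder_iff_pow_eq_one.mpr ⟨q - 1, hq1, ZMod.pow_card_sub_one_eq_one ha⟩).orderOf_pos

/-- `q ∣ a^n - 1 ↔ (a : ZMod q)^n = 1` for `a ≥ 1`. [folklore] -/
theorem dvd_pow_sub_one_iff {a q n : ℕ} (ha : 1 ≤ a) :
    q ∣ a ^ n - 1 ↔ (a : ZMod q) ^ n = 1 := by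
  have h1 : 1 ≤ a ^ n := Nat.one_le_pow n a ha
  rw [← Nat.modEq_iff_dvd' h1, ← ZMod.natCast_eq_natCast_iff, Nat.cast_one, Nat.cast_pow, eq_comm]

/-- **LTE engine (proved).** For an odd prime `q ∤ a` and `x ≠ 0`:
`v_q(a^x - 1) ≤ w_q(a) + v_q(x)`.  (If `q ∣ a^x - 1` then `ord_q(a) ∣ x`, and lifting the exponent from
`a^{ord} - 1` gives equality with `v_q(x / ord) ≤ v_q(x)`; otherwise the left side is `0`.)  This is the
inequality that turns "the fixed-base family `(1, a^x - 1, a^x)` has bounded ω and quality `> 1 + δ`"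
into "some prime power `q^{v_q} ∥ a^x - 1` with `q^{v_q - 1} ≥ a^{cx}`, hence `q^{w_q(a) - 1} ≥ a^{cx}/x`"
(census §S-r1-1). [folklore] -/
theorem padicValNat_pow_sub_one_le {a q x : ℕ} (hq : q.Prime) (hq2 : q ≠ 2) (hqa : ¬ q ∣ a)
    (hx : x ≠ 0) :
    padicValNat q (a ^ x - 1) ≤ wDepth a q + padicValNat q x := by
  haveI := Fact.mk hq
  have ha1 : 1 ≤ a := Nat.pos_of_ne_zero fun h => hqa (h ▸ dvd_zero q)
  rcases ha1.eq_or_lt with ha | ha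
  · -- `a = 1`: the left side is `v_q(0) = 0`.
    subst ha
    simp
  unfold wDepth
  set d := orderOf (a : ZMod q) with hd
  have hd0 : 0 < d := orderOf_pos_of_not_dvd hq hqa
  by_cases hdiv : q ∣ a ^ x - 1
  · have hpow : (a : ZMod q) ^ x = 1 := (dvd_pow_sub_one_iff ha1).mp hdiv
    obtain ⟨m, rfl⟩ : d ∣ x := orderOf_dvd_of_pow_eq_one hpow
    have hm : m ≠ 0 := by
      rintro rfl
      simp at hx
    have had : q ∣ a ^ d - 1 := (dvd_pow_sub_one_iff ha1).mpr (pow_orderOf_eq_one _)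
    have hnd : ¬ q ∣ a ^ d := fun h => hqa (hq.dvd_of_dvd_pow h)
    have h1ad : 1 < a ^ d := Nat.one_lt_pow hd0.ne' ha
    have key := padicValNat.pow_sub_pow (hq.odd_of_ne_two hq2) h1ad had hnd hm
    rw [one_pow] at key
    rw [pow_mul, key, padicValNat.mul hd0.ne' hm]
    omega
  · rw [padicValNat.eq_zero_of_not_dvd hdiv]
    exact Nat.zero_le _

/-- The two known base-2 Wieferich primes have depth EXACTLY 2 at their orders `ord₁₀₉₃(2) = 364 = 2²·7·13`,
`ord₃₅₁₁(2) = 1755 = 3³·5·13` (kernel arithmetic; the orders are certified by `2^{ord/p} ≢ 1 (mod q)` for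
each prime `p ∣ ord`): `2^364 ≡ 1 (mod 1093²)`, `≢ 1 (mod 1093³)`, and likewise for 3511.  So
`q^{w-1} = q`: they are `c`-super-Wieferich exactly for `c ≤ log₂ q / ord_q(2) = 0.0277`, resp. `0.0067`
— two primes, where the reduction `FixedBaseNeedsSuperWieferich` needs infinitely many at one fixed `c`.
[folklore] -/
example : 2 ^ 364 % 1093 ^ 2 = 1 ∧ 2 ^ 364 % 1093 ^ 3 ≠ 1 ∧ 2 ^ 182 % 1093 ≠ 1 ∧ 2 ^ 52 % 1093 ≠ 1 ∧
    2 ^ 28 % 1093 ≠ 1 := by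
  decide +kernel

example : 2 ^ 1755 % 3511 ^ 2 = 1 ∧ 2 ^ 1755 % 3511 ^ 3 ≠ 1 ∧ 2 ^ 585 % 3511 ≠ 1 ∧ 2 ^ 351 % 3511 ≠ 1 ∧
    2 ^ 135 % 3511 ≠ 1 := by
  decide +kernel

/-- The `c`-**super-Wieferich** primes of the base `a`: primes `q ∤ a` of Wieferich depth `w ≥ 2` whose
excess `q^{w-1}` beats `a^{c · ord_q(a)}`.  Heuristically FINITE for every `c > 0` (a prime of order `d`
is `c`-super-Wieferich with "probability" `≲ a^{-cd}`, and there are `≤ d·log a` primes of order `d`),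
but not provably so — this set is where the whole difficulty of the fixed-base sub-family sits.
[folklore] -/
def SuperWieferich (a : ℕ) (c : ℝ) : Set ℕ :=
  {q | q.Prime ∧ ¬ q ∣ a ∧ 2 ≤ wDepth a q ∧
    (a : ℝ) ^ (c * (orderOf (a : ZMod q) : ℝ)) ≤ (q : ℝ) ^ ((wDepth a q : ℝ) - 1)}

/-- Exponents `x` for which the fixed-base triple `(1, a^x - 1, a^x)` is a level-`k`, margin-`δ`
violator. [folklore] -/
def FixedBaseViolators (a k : ℕ) (δ : ℝ) : Set ℕ :=
  {x | ((a ^ x - 1) * a ^ x).primeFactors.card ≤ k ∧ 1 + δ < quality 1 (a ^ x - 1) (a ^ x)}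

/-- `(1, a^x - 1, a^x)` is an abc triple for `a ≥ 2`, `x ≠ 0`. [folklore] -/
theorem isABCTriple_fixedBase {a x : ℕ} (ha : 2 ≤ a) (hx : x ≠ 0) :
    IsABCTriple 1 (a ^ x - 1) (a ^ x) := by
  have h1 : 1 < a ^ x := Nat.one_lt_pow hx (by omega)
  refine ⟨Nat.one_pos, by omega, by omega, Nat.coprime_one_left _⟩

/-- **The fixed-base family is a genuine sub-family of the crux** (level `k`, margin `δ`): so
`FixedBaseNeedsSuperWieferich` below types an honest STRENGTHENING `S⁺` of the crux, not a costume.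
[folklore] -/
theorem fixedBase_sub_crux {a k : ℕ} {δ : ℝ} (ha : 2 ≤ a) (hδ : 0 < δ)
    (h : (FixedBaseViolators a k δ).Infinite) :
    {t : ℕ × ℕ × ℕ | IsABCTriple t.1 t.2.1 t.2.2 ∧ (t.1 * t.2.1 * t.2.2).primeFactors.card ≤ k ∧
      1 + δ < quality t.1 t.2.1 t.2.2}.Infinite := by
  have hinj : Set.InjOn (fun x : ℕ => ((1 : ℕ), a ^ x - 1, a ^ x)) (FixedBaseViolators a k δ) := by
    intro x _ y _ hxy
    simp only [Prod.mk.injEq] at hxy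
    exact Nat.pow_right_injective ha hxy.2.2
  refine (h.image hinj).mono ?_
  rintro _ ⟨x, hxmem, rfl⟩
  have hx : x ≠ 0 := by
    rintro rfl
    have hq : 1 + δ < quality 1 (a ^ 0 - 1) (a ^ 0) := hxmem.2
    simp [quality] at hq
    linarith
  refine ⟨isABCTriple_fixedBase ha hx, ?_, hxmem.2⟩
  simpa only [one_mul] using hxmem.1

/-- **THE REDUCTION (stated here, PROVED below as `fixedBaseNeedsSuperWieferich`; census §S⁺-r1-1).**
An infinite fixed-base sub-family of the crux forces infinitely many `c`-super-Wieferich primes of the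
base, `c = δ / (2(1+δ)k)`.  Proof: for `x` in the family, `rad(a^x - 1) ≤ rad(abc) < a^{x/(1+δ)}`, so
`∏ q_i^{e_i - 1} = (a^x - 1)/rad(a^x - 1) > a^{xδ/(1+δ)}/2` over the `≤ k` primes `q_i^{e_i} ∥ a^x - 1`;
the largest factor has `q^{e-1} ≥ (a^{xδ/(1+δ)}/2)^{1/k}`; the uniform LTE engine
`padicValNat_pow_sub_one_le_depthBound` gives `e ≤ depthBound + v_q(x)` with `q^{v_q(x)} ≤ x`, so
`q^{depthBound-1} > a^{cx}` for large `x` (`exists_prime_pow_gt_of_violator`); `q = 2` is then excluded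
(`depthBound a 2` is constant), so `depthBound = w_q(a)`, `q^{w_q(a)-1} > a^{cx} ≥ a^{c·ord_q(a)}`
(as `ord_q(a) ∣ x`) and `w_q(a) ≥ 2`; finally `a^{cx} → ∞` beats any finite set of such `q`.
[folklore] -/
def FixedBaseNeedsSuperWieferich : Prop :=
  ∀ a k : ℕ, ∀ δ : ℝ, 2 ≤ a → 0 < δ → (FixedBaseViolators a k δ).Infinite →
    (SuperWieferich a (δ / (2 * (1 + δ) * k))).Infinite

/-! ### §3b The reduction `FixedBaseNeedsSuperWieferich`, kernel-checked -/

/-- Depth bound uniform in the prime: `w_q(a)` for odd `q`, and `v_2(a+1) + v_2(a-1)` at `q = 2`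
(where plain LTE fails: `v_2(3^2 - 1) = 3 > v_2(3 - 1) + v_2(2)`). [folklore] -/
noncomputable def depthBound (a q : ℕ) : ℕ :=
  if q = 2 then padicValNat 2 (a + 1) + padicValNat 2 (a - 1) else wDepth a q

/-- Monotonicity of `v_p` under divisibility. [folklore] -/
theorem padicValNat_le_of_dvd {p m n : ℕ} (hp : p.Prime) (h : m ∣ n) (hn : n ≠ 0) :
    padicValNat p m ≤ padicValNat p n := by
  haveI := Fact.mk hp
  exact (padicValNat_dvd_iff_le hn).mp (pow_padicValNat_dvd.trans h)

/-- The `2`-adic bound: `v_2(a^x - 1) ≤ v_2(a+1) + v_2(a-1) + v_2(x)` for odd `a`, `x ≠ 0`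
(via `v_2(a^{2x} - 1) = v_2(a+1) + v_2(a-1) + v_2(x)`, Mathlib's `padicValNat.pow_two_sub_pow`).
[folklore] -/
theorem padicValNat_two_pow_sub_one_le {a x : ℕ} (ha : ¬ 2 ∣ a) (hx : x ≠ 0) :
    padicValNat 2 (a ^ x - 1) ≤ padicValNat 2 (a + 1) + padicValNat 2 (a - 1) + padicValNat 2 x := by
  have ha1 : 1 ≤ a := Nat.pos_of_ne_zero fun h => ha (h ▸ dvd_zero 2)
  rcases ha1.eq_or_lt with h1 | h1
  · subst h1
    simp
  have hdvd : a ^ x - 1 ∣ a ^ (x * 2) - 1 := by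
    have h := Nat.sub_one_dvd_pow_sub_one (a ^ x) 2
    rwa [← pow_mul] at h
  have hne : a ^ (x * 2) - 1 ≠ 0 := by
    have : 1 < a ^ (x * 2) := Nat.one_lt_pow (by omega) h1
    omega
  have h2 := padicValNat_le_of_dvd Nat.prime_two hdvd hne
  have key := padicValNat.pow_two_sub_pow h1 (by omega) ha (n := x * 2) (by omega) ⟨x, by ring⟩
  rw [one_pow, padicValNat.mul hx two_ne_zero, padicValNat_self] at key
  omega

/-- **Uniform LTE engine.** For every prime `q ∤ a` and `x ≠ 0`:
`v_q(a^x - 1) ≤ depthBound a q + v_q(x)`. [folklore] -/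
theorem padicValNat_pow_sub_one_le_depthBound {a q x : ℕ} (hq : q.Prime) (hqa : ¬ q ∣ a)
    (hx : x ≠ 0) : padicValNat q (a ^ x - 1) ≤ depthBound a q + padicValNat q x := by
  unfold depthBound
  split_ifs with h2
  · subst h2
    exact padicValNat_two_pow_sub_one_le hqa hx
  · exact padicValNat_pow_sub_one_le hq h2 hqa hx

/-- Real-exponent bookkeeping: `(α^x)^(c·m) = (α^c)^(m·x)`. [folklore] -/
theorem rpow_pow_comm {α : ℝ} (hα : 0 ≤ α) (c : ℝ) (m x : ℕ) :
    (α ^ x) ^ (c * m) = (α ^ c) ^ (m * x) := by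
  rw [← Real.rpow_natCast α x, ← Real.rpow_mul hα, ← Real.rpow_mul_natCast hα]
  congr 1
  push_cast
  ring

/-- **Core step (one exponent).** If `x ≥ 2` is a level-`k`, margin-`δ` fixed-base violator and
`2x^k < (a^c)^{kx}` (true for all large `x`), where `c · 2k = δ/(1+δ)`, then some prime `q ∣ a^x - 1`
has `q^{depthBound - 1} > (a^c)^x`.  Proof: `rad(a^x-1) ≤ rad(abc) < (a^x)^{1/(1+δ)}` so the cofactor
`A = ∏ q^{v_q - 1} = (a^x-1)/rad(a^x-1)` exceeds `(a^x)^{δ/(1+δ)}/2 = (a^c)^{2kx}/2`; pigeonhole over the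
`≤ k` primes and the uniform LTE engine give `A ≤ (q^{depthBound-1}·x)^k`. [folklore] -/
theorem exists_prime_pow_gt_of_violator {a k x : ℕ} {δ c : ℝ} (ha : 2 ≤ a) (hδ : 0 < δ)
    (hck : c * (2 * (k : ℝ)) = δ / (1 + δ)) (hx2 : 2 ≤ x) (hv : x ∈ FixedBaseViolators a k δ)
    (hE1 : 2 * (x : ℝ) ^ k < ((a : ℝ) ^ c) ^ (k * x)) :
    ∃ q : ℕ, q.Prime ∧ ¬ q ∣ a ∧ q ∣ a ^ x - 1 ∧
      ((a : ℝ) ^ c) ^ x < ((q ^ (depthBound a q - 1) : ℕ) : ℝ) := by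
  have hx0 : x ≠ 0 := by omega
  have ha1 : 1 ≤ a := by omega
  have hC4 : 4 ≤ a ^ x :=
    calc 4 = 2 ^ 2 := by norm_num
      _ ≤ a ^ 2 := Nat.pow_le_pow_left ha 2
      _ ≤ a ^ x := Nat.pow_le_pow_right (by omega) hx2
  set n := a ^ x - 1 with hn
  have hn1 : 1 < n := by omega
  have hn0 : n ≠ 0 := by omega
  have hax0 : a ^ x ≠ 0 := by omega
  -- Step A: the radical bound from the quality margin.
  have habc : IsABCTriple 1 n (a ^ x) := isABCTriple_fixedBase ha hx0
  have hR : ((rad 1 n (a ^ x) : ℕ) : ℝ) < ((a ^ x : ℕ) : ℝ) ^ (1 - δ / (1 + δ)) :=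
    rad_lt_rpow_of_quality habc hδ hv.2
  -- Step B: `radical n ≤ rad(1 · n · a^x)`.
  have hradle : radical n ≤ rad 1 n (a ^ x) := by
    rw [rad_def]
    exact Nat.le_of_dvd (pos_of_ne_zero radical_ne_zero)
      (radical_dvd_radical ⟨a ^ x, by ring⟩ (mul_ne_zero (mul_ne_zero one_ne_zero hn0) hax0))
  -- Step C: `n = A · radical n` with `A = ∏ p^{v_p(n) - 1}`.
  set A := ∏ p ∈ n.primeFactors, p ^ (n.factorization p - 1) with hA
  have hnA : A * radical n = n := by
    rw [Nat.radical_eq_prod_primeFactors, ← Finset.prod_mul_distrib]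
    conv_rhs => rw [Nat.prod_primeFactors_pow_factorization hn0]
    refine Finset.prod_congr rfl fun p hp => ?_
    have hpp := Nat.mem_primeFactors.mp hp
    have hfp : 0 < n.factorization p := hpp.1.factorization_pos_of_dvd hn0 hpp.2.1
    rw [← pow_succ]
    congr 1
    omega
  -- Step D: at most `k` primes divide `n`.
  have hcard : n.primeFactors.card ≤ k := by
    refine le_trans (Finset.card_le_card ?_) hv.1
    exact Nat.primeFactors_mono ⟨a ^ x, rfl⟩ (mul_ne_zero hn0 hax0)
  -- Step E: pigeonhole on the largest prime-power cofactor.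
  have hne : n.primeFactors.Nonempty := Nat.nonempty_primeFactors.mpr hn1
  obtain ⟨q, hq, hqmax⟩ :=
    Finset.exists_max_image n.primeFactors (fun p => p ^ (n.factorization p - 1)) hne
  have hqP : q.Prime := Nat.prime_of_mem_primeFactors hq
  have hqn : q ∣ n := Nat.dvd_of_mem_primeFactors hq
  set g := q ^ (n.factorization q - 1) with hg
  have hg1 : 1 ≤ g := Nat.one_le_pow _ _ hqP.pos
  have hAle : A ≤ g ^ k :=
    calc A ≤ g ^ n.primeFactors.card := Finset.prod_le_pow_card _ _ _ hqmax
      _ ≤ g ^ k := Nat.pow_le_pow_right hg1 hcard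
  -- Step F: `q ∤ a`, and the LTE bound `g ≤ q^{depthBound - 1} · x`.
  have hqa : ¬ q ∣ a := by
    intro h
    have h1 : q ∣ a ^ x := dvd_pow h hx0
    have h2 : q ∣ a ^ x - n := Nat.dvd_sub h1 hqn
    have h3 : a ^ x - n = 1 := by omega
    rw [h3] at h2
    exact hqP.one_lt.ne' (Nat.dvd_one.mp h2)
  have hdb : n.factorization q ≤ depthBound a q + padicValNat q x := by
    rw [Nat.factorization_def n hqP]
    exact padicValNat_pow_sub_one_le_depthBound hqP hqa hx0
  set G := q ^ (depthBound a q - 1) with hG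
  have hgle : g ≤ G * x :=
    calc g = q ^ (n.factorization q - 1) := rfl
      _ ≤ q ^ (depthBound a q - 1 + padicValNat q x) := Nat.pow_le_pow_right hqP.pos (by omega)
      _ = G * q ^ padicValNat q x := pow_add _ _ _
      _ ≤ G * x := Nat.mul_le_mul_left _ (Nat.le_of_dvd (Nat.pos_of_ne_zero hx0) pow_padicValNat_dvd)
  refine ⟨q, hqP, hqa, hqn, ?_⟩
  -- Step G: the real inequalities.
  by_contra hcon
  push Not at hcon
  have hα1 : (1 : ℝ) < a := by exact_mod_cast (show 1 < a by omega)
  have hα0 : (0 : ℝ) ≤ a := by positivity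
  have hσ0 : 0 < (a : ℝ) ^ c := Real.rpow_pos_of_pos (by positivity) c
  set C : ℝ := ((a ^ x : ℕ) : ℝ) with hCdef
  set θ : ℝ := δ / (1 + δ) with hθdef
  have hCpos : 0 < C := by
    rw [hCdef]
    exact_mod_cast Nat.pos_of_ne_zero hax0
  have hCθ : 0 < C ^ θ := Real.rpow_pos_of_pos hCpos θ
  have hsplit : C ^ θ * C ^ (1 - θ) = C := by
    rw [← Real.rpow_add hCpos, show θ + (1 - θ) = 1 by ring, Real.rpow_one]
  -- `C^θ = (a^c)^(2kx)`.
  have hCθeq : C ^ θ = ((a : ℝ) ^ c) ^ (2 * k * x) := by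
    have h1 : C = (a : ℝ) ^ x := by rw [hCdef]; push_cast; rfl
    have h2 : θ = c * ((2 * k : ℕ) : ℝ) := by rw [← hck]; push_cast; ring
    rw [h1, h2, rpow_pow_comm hα0]
  -- `n ≤ A · R`, `C ≤ 2n`, hence `C^θ < 2A`.
  have hnR : (n : ℝ) ≤ (A : ℝ) * ((rad 1 n (a ^ x) : ℕ) : ℝ) := by
    have h1 : (n : ℝ) = (A : ℝ) * ((radical n : ℕ) : ℝ) := by exact_mod_cast hnA.symm
    rw [h1]
    exact mul_le_mul_of_nonneg_left (by exact_mod_cast hradle) (Nat.cast_nonneg _)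
  have hCn : C ≤ 2 * (n : ℝ) := by
    have h1 : a ^ x ≤ 2 * n := by omega
    calc C = ((a ^ x : ℕ) : ℝ) := rfl
      _ ≤ ((2 * n : ℕ) : ℝ) := by exact_mod_cast h1
      _ = 2 * (n : ℝ) := by push_cast; ring
  have hkey : C ^ θ < 2 * (A : ℝ) := by
    by_contra h
    push Not at h
    have hR0 : (0 : ℝ) ≤ ((rad 1 n (a ^ x) : ℕ) : ℝ) := Nat.cast_nonneg _
    have : C < C :=
      calc C ≤ 2 * (n : ℝ) := hCn
        _ ≤ 2 * ((A : ℝ) * ((rad 1 n (a ^ x) : ℕ) : ℝ)) := by linarith [hnR]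
        _ = (2 * (A : ℝ)) * ((rad 1 n (a ^ x) : ℕ) : ℝ) := by ring
        _ ≤ C ^ θ * ((rad 1 n (a ^ x) : ℕ) : ℝ) := by gcongr
        _ < C ^ θ * C ^ (1 - θ) := by gcongr
        _ = C := hsplit
    exact lt_irrefl _ this
  -- `A ≤ (G x)^k ≤ ((a^c)^x · x)^k`.
  have hA2 : (A : ℝ) ≤ (((a : ℝ) ^ c) ^ x * x) ^ k := by
    have h1 : (A : ℝ) ≤ (((G * x) ^ k : ℕ) : ℝ) := by
      exact_mod_cast hAle.trans (Nat.pow_le_pow_left hgle k)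
    refine h1.trans ?_
    push_cast
    gcongr
  have hpos : (0 : ℝ) < ((a : ℝ) ^ c) ^ (k * x) := pow_pos hσ0 _
  have h3 : ((a : ℝ) ^ c) ^ (2 * k * x) < 2 * ((((a : ℝ) ^ c) ^ x * x) ^ k) := by
    rw [← hCθeq]; linarith [hkey, hA2]
  have h4 : ((a : ℝ) ^ c) ^ (2 * k * x) = ((a : ℝ) ^ c) ^ (k * x) * ((a : ℝ) ^ c) ^ (k * x) := by
    rw [← pow_add]; ring_nf
  have h5 : (((a : ℝ) ^ c) ^ x * (x : ℝ)) ^ k = ((a : ℝ) ^ c) ^ (k * x) * (x : ℝ) ^ k := by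
    rw [mul_pow, ← pow_mul, Nat.mul_comm x k]
  rw [h4, h5] at h3
  have h6 : ((a : ℝ) ^ c) ^ (k * x) < 2 * (x : ℝ) ^ k := by
    by_contra h7
    push Not at h7
    nlinarith [hpos, h7, h3]
  linarith [hE1, h6]

/-- **`FixedBaseNeedsSuperWieferich`, PROVED.** [folklore] -/
theorem fixedBaseNeedsSuperWieferich : FixedBaseNeedsSuperWieferich := by
  intro a k δ ha hδ hV
  have hC4 : ∀ {x : ℕ}, 2 ≤ x → 4 ≤ a ^ x := fun {x} hx2 =>
    calc 4 = 2 ^ 2 := by norm_num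
      _ ≤ a ^ 2 := Nat.pow_le_pow_left ha 2
      _ ≤ a ^ x := Nat.pow_le_pow_right (by omega) hx2
  rcases Nat.eq_zero_or_pos k with hk0 | hk
  · -- `k = 0`: no violator has `ω((a^x-1)a^x) = 0`, so the hypothesis is vacuous.
    exfalso
    subst hk0
    obtain ⟨x, hxV, hx2⟩ := hV.exists_gt 2
    have h4 := hC4 hx2.le
    have hne : ((a ^ x - 1) * a ^ x).primeFactors.Nonempty := by
      refine Nat.nonempty_primeFactors.mpr ?_
      have : 3 * 4 ≤ (a ^ x - 1) * a ^ x := Nat.mul_le_mul (by omega) h4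
      omega
    have hcard : ((a ^ x - 1) * a ^ x).primeFactors.card ≤ 0 := hxV.1
    exact absurd (Nat.le_zero.mp hcard) (Finset.card_pos.mpr hne).ne'
  -- `k ≥ 1`.
  obtain ⟨c, hc⟩ : ∃ c : ℝ, c = δ / (2 * (1 + δ) * k) := ⟨_, rfl⟩
  rw [← hc]
  have hk' : (k : ℝ) ≠ 0 := by exact_mod_cast hk.ne'
  have h1δ : (0 : ℝ) < 1 + δ := by linarith
  have hcpos : 0 < c := by rw [hc]; positivity
  have hck : c * (2 * (k : ℝ)) = δ / (1 + δ) := by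
    rw [hc]
    field_simp
  have hα1 : (1 : ℝ) < a := by exact_mod_cast (show 1 < a by omega)
  have hσ1 : 1 < (a : ℝ) ^ c := Real.one_lt_rpow hα1 hcpos
  have hσ0 : 0 < (a : ℝ) ^ c := lt_trans one_pos hσ1
  by_contra hfin
  rw [Set.not_infinite] at hfin
  -- A bound `M` for `q^{w_q - 1}` over the (finitely many) super-Wieferich primes.
  set M : ℝ := ∑ q ∈ hfin.toFinset, ((q ^ (wDepth a q - 1) : ℕ) : ℝ) with hM
  have hMbound : ∀ q ∈ SuperWieferich a c, ((q ^ (wDepth a q - 1) : ℕ) : ℝ) ≤ M := fun q hq =>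
    Finset.single_le_sum (f := fun q => ((q ^ (wDepth a q - 1) : ℕ) : ℝ)) (fun _ _ => by positivity)
      (hfin.mem_toFinset.mpr hq)
  -- Eventualities in `x`.
  have hρ1 : 1 < ((a : ℝ) ^ c) ^ k := one_lt_pow₀ hσ1 hk.ne'
  have e1 : ∀ᶠ x : ℕ in Filter.atTop, 2 * (x : ℝ) ^ k < ((a : ℝ) ^ c) ^ (k * x) := by
    have ht := tendsto_pow_const_div_const_pow_of_one_lt k hρ1
    have hev := (tendsto_order.1 ht).2 (1 / 2) (by norm_num)
    filter_upwards [hev] with x hx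
    have hpos : (0 : ℝ) < (((a : ℝ) ^ c) ^ k) ^ x := pow_pos (lt_trans one_pos hρ1) _
    rw [div_lt_iff₀ hpos] at hx
    rw [pow_mul]
    linarith
  have e2 : ∀ᶠ x : ℕ in Filter.atTop, ((2 ^ (depthBound a 2 - 1) : ℕ) : ℝ) < ((a : ℝ) ^ c) ^ x :=
    (tendsto_pow_atTop_atTop_of_one_lt hσ1).eventually_gt_atTop _
  have e3 : ∀ᶠ x : ℕ in Filter.atTop, M < ((a : ℝ) ^ c) ^ x :=
    (tendsto_pow_atTop_atTop_of_one_lt hσ1).eventually_gt_atTop _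
  obtain ⟨N, hN⟩ :=
    Filter.eventually_atTop.mp (e1.and (e2.and (e3.and (Filter.eventually_ge_atTop 2))))
  obtain ⟨x, hxV, hNx⟩ := hV.exists_gt N
  obtain ⟨h1, h2, h3, hx2⟩ := hN x hNx.le
  obtain ⟨q, hqP, hqa, hqn, hlt⟩ := exists_prime_pow_gt_of_violator ha hδ hck hx2 hxV h1
  -- `q ≠ 2` for such `x`.
  have hq2 : q ≠ 2 := by
    rintro rfl
    exact lt_irrefl _ (h2.trans hlt)
  have hdbq : depthBound a q = wDepth a q := by simp [depthBound, hq2]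
  rw [hdbq] at hlt
  -- `q` is `c`-super-Wieferich.
  have hw2 : 2 ≤ wDepth a q := by
    by_contra hw
    push Not at hw
    have h0 : wDepth a q - 1 = 0 := by omega
    rw [h0, pow_zero, Nat.cast_one] at hlt
    have : (1 : ℝ) ≤ ((a : ℝ) ^ c) ^ x := one_le_pow₀ hσ1.le
    linarith
  have hx0 : x ≠ 0 := by omega
  have hordx : orderOf (a : ZMod q) ≤ x := by
    apply Nat.le_of_dvd (Nat.pos_of_ne_zero hx0)
    apply orderOf_dvd_of_pow_eq_one
    exact (dvd_pow_sub_one_iff (by omega : 1 ≤ a)).mp hqn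
  have hmem : q ∈ SuperWieferich a c := by
    refine ⟨hqP, hqa, hw2, ?_⟩
    have hw1 : 1 ≤ wDepth a q := by omega
    calc (a : ℝ) ^ (c * (orderOf (a : ZMod q) : ℝ)) = ((a : ℝ) ^ c) ^ (orderOf (a : ZMod q)) :=
          Real.rpow_mul_natCast (by positivity) c _
      _ ≤ ((a : ℝ) ^ c) ^ x := pow_le_pow_right₀ hσ1.le hordx
      _ ≤ ((q ^ (wDepth a q - 1) : ℕ) : ℝ) := hlt.le
      _ = (q : ℝ) ^ ((wDepth a q : ℝ) - 1) := by
          rw [Nat.cast_pow, ← Real.rpow_natCast, Nat.cast_sub hw1, Nat.cast_one]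
  have hMq := hMbound q hmem
  linarith [h3, hlt]

end Summit.ABC.ABC.Cruxes.NegThesis.StrategyCensusR1
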